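import Summits.AnomalousDissipation.AnomalousDissipation.Theorems.MomentParityQuarticGateDesignSymShiftOp
import Summits.AnomalousDissipation.AnomalousDissipation.Theorems.MomentParityQuarticGateAtoms
import Mathlib.Algebra.Order.Chebyshev

/-!
# Averaging a design over a finite shear group

Helper file for stub S6′ (`stub_order2DesignSym`) of the line `axis-sectors` of crux
`MomentParity.QuarticGate`. Given a family of shift homeomorphisms `T a : H ≃ₜ H` (represented a.e.
by `u ↦ u(· + a)`, file `…DesignSymShiftOp`) and finitely many shear translations `e p`, `p : κ`,
the AVERAGED law `μ' = (#κ)⁻¹ • ∑ₚ (T (e p))_* μ` of a level-`N` design `μ₀` is computed clause by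
clause: almost-sure statements, integrals and lower integrals are finite averages of the translated
ones (the `T a` are measurable embeddings), so level, bounded support, the linear / energy /
helicity rows, the mean energy and the dissipation are inherited from `μ` for a shear-invariant
force; the NONDEGENERATE COVARIANCE is inherited by Jensen's inequality; and when the translations
form a subgroup `{e p}` containing the finite shear group `H_L`, the cylindrical laws of `μ'` are
`H_L`-invariant (reindexing the average). The last section builds the grid
`(ℤ/L)² → H_L`, `p ↦ (p₁/L, 0, p₂/L)` and assembles `exists_lawSym_of_design`.
-/

namespace Summit.AnomalousDissipation.AnomalousDissipation.Theorems.MomentParityQuarticGate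

open MeasureTheory Filter
open scoped InnerProductSpace RealInnerProductSpace ENNReal
open Literature.Analysis.FunctionSpaces Literature.Analysis.FluidPDE
open Summit.AnomalousDissipation.AnomalousDissipation.Theorems.QuarticGate.Negative

set_option linter.dupNamespace false

noncomputable section

/-- Pushing forward commutes with finite sums of measures. [folklore] -/
theorem map_finsetSum_measure {α β ι : Type*} {mα : MeasurableSpace α} {mβ : MeasurableSpace β}
    {f : α → β} (hf : Measurable f) (s : Finset ι) (μ : ι → Measure α) :
    Measure.map f (∑ i ∈ s, μ i) = ∑ i ∈ s, Measure.map f (μ i) := by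
  classical
  induction s using Finset.induction_on with
  | empty => simp
  | insert a s ha ih => rw [Finset.sum_insert ha, Finset.sum_insert ha, Measure.map_add _ _ hf, ih]

section Average

variable {κ : Type*} [Fintype κ]
  {T : UnitAddTorus (Fin 3) → Torus.energySpace (Fin 3) ≃ₜ Torus.energySpace (Fin 3)}
  (e : κ → UnitAddTorus (Fin 3)) (μ : Measure (Torus.energySpace (Fin 3)))

/-- The number of translations, as an extended non-negative real, is neither `0` nor `∞`. [folklore] -/
theorem card_shifts_ne_zero [Nonempty κ] : ((Fintype.card κ : ℝ≥0∞)) ≠ 0 ∧ ((Fintype.card κ : ℝ≥0∞)) ≠ ∞ :=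
  ⟨by exact_mod_cast Fintype.card_ne_zero, ENNReal.natCast_ne_top _⟩

variable (T) in
/-- **The averaged law is a probability measure.** [folklore] -/
theorem isProbabilityMeasure_shiftAverage [Nonempty κ] [IsProbabilityMeasure μ] :
    IsProbabilityMeasure (((Fintype.card κ : ℝ≥0∞))⁻¹ • ∑ p, Measure.map (T (e p)) μ) := by
  refine ⟨?_⟩
  rw [Measure.smul_apply, Measure.finsetSum_apply, smul_eq_mul]
  have h : ∀ p, Measure.map (T (e p)) μ Set.univ = 1 := fun p => by
    rw [Measure.map_apply (T (e p)).continuous.measurable MeasurableSet.univ, Set.preimage_univ, measure_univ]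
  simp only [h, Finset.sum_const, Finset.card_univ, nsmul_eq_mul, mul_one]
  exact ENNReal.inv_mul_cancel card_shifts_ne_zero.1 card_shifts_ne_zero.2

variable (T) in
/-- **Almost-sure statements for the averaged law** follow from the translated statements for `μ`.
[folklore] -/
theorem ae_shiftAverage {P : Torus.energySpace (Fin 3) → Prop} (h : ∀ p, ∀ᵐ u ∂μ, P (T (e p) u)) :
    ∀ᵐ u ∂(((Fintype.card κ : ℝ≥0∞))⁻¹ • ∑ p, Measure.map (T (e p)) μ), P u :=
  Measure.ae_smul_measure (ae_finsetSum_measure _ _ fun p _ =>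
    ((T (e p)).measurableEmbedding.ae_map_iff).2 (h p)) _

variable (T) in
/-- **Integrability against the averaged law** follows from integrability of the translates.
[folklore] -/
theorem integrable_shiftAverage [Nonempty κ] {F : Torus.energySpace (Fin 3) → ℝ}
    (h : ∀ p, Integrable (fun u => F (T (e p) u)) μ) :
    Integrable F (((Fintype.card κ : ℝ≥0∞))⁻¹ • ∑ p, Measure.map (T (e p)) μ) :=
  (integrable_finsetSum_measure.2 fun p _ => ((T (e p)).measurableEmbedding.integrable_map_iff).2 (h p)).smul_measure
    (ENNReal.inv_ne_top.2 card_shifts_ne_zero.1)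

variable (T) in
/-- **Integrals against the averaged law are averages of translated integrals**:
`∫ F dμ' = (#κ)⁻¹ ∑ₚ ∫ F (T (e p) u) dμ`. [folklore] -/
theorem integral_shiftAverage {F : Torus.energySpace (Fin 3) → ℝ}
    (h : ∀ p, Integrable (fun u => F (T (e p) u)) μ) :
    ∫ u, F u ∂(((Fintype.card κ : ℝ≥0∞))⁻¹ • ∑ p, Measure.map (T (e p)) μ) =
      (Fintype.card κ : ℝ)⁻¹ * ∑ p, ∫ u, F (T (e p) u) ∂μ := by
  rw [integral_smul_measure, integral_finsetSum_measure fun p _ =>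
    ((T (e p)).measurableEmbedding.integrable_map_iff).2 (h p)]
  simp only [(T (e _)).measurableEmbedding.integral_map, ENNReal.toReal_inv, ENNReal.toReal_natCast,
    smul_eq_mul]

variable (T) in
/-- **Lower integrals against the averaged law are averages of translated lower integrals.**
[folklore] -/
theorem lintegral_shiftAverage (G : Torus.energySpace (Fin 3) → ℝ≥0∞) :
    ∫⁻ u, G u ∂(((Fintype.card κ : ℝ≥0∞))⁻¹ • ∑ p, Measure.map (T (e p)) μ) =
      ((Fintype.card κ : ℝ≥0∞))⁻¹ * ∑ p, ∫⁻ u, G (T (e p) u) ∂μ := by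
  rw [lintegral_smul_measure, lintegral_finsetSum_measure]
  simp only [(T (e _)).measurableEmbedding.lintegral_map, smul_eq_mul]

variable (T) in
/-- **An invariant integrable observable has the same mean under the averaged law.** [folklore] -/
theorem integral_shiftAverage_of_invariant [Nonempty κ] {F : Torus.energySpace (Fin 3) → ℝ}
    (hinv : ∀ p u, F (T (e p) u) = F u) (h : Integrable F μ) :
    ∫ u, F u ∂(((Fintype.card κ : ℝ≥0∞))⁻¹ • ∑ p, Measure.map (T (e p)) μ) = ∫ u, F u ∂μ := by
  rw [integral_shiftAverage T e μ fun p => by simp_rw [hinv p]; exact h]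
  simp_rw [hinv]
  rw [Finset.sum_const, Finset.card_univ, nsmul_eq_mul, ← mul_assoc,
    inv_mul_cancel₀ (by exact_mod_cast Fintype.card_ne_zero), one_mul]

variable (hT : ∀ (a : UnitAddTorus (Fin 3)) (u : Torus.energySpace (Fin 3)),
    (((T a u).1 : Lp (EuclideanSpace ℝ (Fin 3)) 2 (volume : Measure (UnitAddTorus (Fin 3)))) :
        UnitAddTorus (Fin 3) → EuclideanSpace ℝ (Fin 3)) =ᵐ[volume]
      fun x => ((u.1 : Lp (EuclideanSpace ℝ (Fin 3)) 2 (volume : Measure (UnitAddTorus (Fin 3)))) :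
        UnitAddTorus (Fin 3) → EuclideanSpace ℝ (Fin 3)) (x + a))

include hT

/-- **The averaged law of a level-`N` law is level-`N`.** [folklore] -/
theorem ae_isLevel_shiftAverage {N : ℕ} (hlev : ∀ᵐ u ∂μ, IsLevel N u) :
    ∀ᵐ u ∂(((Fintype.card κ : ℝ≥0∞))⁻¹ • ∑ p, Measure.map (T (e p)) μ), IsLevel N u :=
  ae_shiftAverage T e μ fun p => hlev.mono fun u hu => (isLevel_shiftOp_iff hT N (e p) u).2 hu

/-- **The averaged law of a boundedly supported law is boundedly supported** (same radius).
[folklore] -/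
theorem ae_norm_le_shiftAverage {R : ℝ} (hR : ∀ᵐ u ∂μ, ‖u‖ ≤ R) :
    ∀ᵐ u ∂(((Fintype.card κ : ℝ≥0∞))⁻¹ • ∑ p, Measure.map (T (e p)) μ), ‖u‖ ≤ R :=
  ae_shiftAverage T e μ fun p => hR.mono fun u hu => by rwa [norm_shiftOp hT]

/-- **Mean energy of the averaged law** (bounded support). [folklore] -/
theorem ensembleEnergy_shiftAverage [Nonempty κ] [IsProbabilityMeasure μ] {R : ℝ} (hR : ∀ᵐ u ∂μ, ‖u‖ ≤ R) :
    Torus.ensembleEnergy (((Fintype.card κ : ℝ≥0∞))⁻¹ • ∑ p, Measure.map (T (e p)) μ) =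
      Torus.ensembleEnergy μ := by
  unfold Torus.ensembleEnergy
  refine integral_shiftAverage_of_invariant T e μ (fun p u => by rw [norm_shiftOp hT]) ?_
  refine Integrable.mono' (integrable_const (R ^ 2)) (continuous_norm.pow 2).aestronglyMeasurable
    (hR.mono fun u hu => ?_)
  rw [Real.norm_eq_abs, abs_of_nonneg (sq_nonneg _)]
  exact pow_le_pow_left₀ (norm_nonneg _) hu 2

/-- **Dissipation of the averaged law.** [folklore] -/
theorem ensembleDissipation_shiftAverage [Nonempty κ] (ν : ℝ) :
    Torus.ensembleDissipation ν (((Fintype.card κ : ℝ≥0∞))⁻¹ • ∑ p, Measure.map (T (e p)) μ) =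
      Torus.ensembleDissipation ν μ := by
  unfold Torus.ensembleDissipation Torus.ensembleEnstrophy
  rw [lintegral_shiftAverage T e μ]
  simp_rw [eGradNormSq_shiftOp hT]
  rw [Finset.sum_const, Finset.card_univ, nsmul_eq_mul, ← mul_assoc,
    ENNReal.inv_mul_cancel card_shifts_ne_zero.1 card_shifts_ne_zero.2, one_mul]

/-- **Linear rows of the averaged law** for a force fixed by all the translations: if every linear
row of `μ` (band tests of level `N`) is integrable and vanishes, so is every linear row of the
averaged law. [folklore] -/
theorem linearRow_shiftAverage [Nonempty κ] (ν : ℝ) {f : UnitAddTorus (Fin 3) → EuclideanSpace ℝ (Fin 3)}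
    (hf : ∀ p x, f (x + e p) = f x) {N : ℕ}
    (hlin : ∀ g : UnitAddTorus (Fin 3) → EuclideanSpace ℝ (Fin 3), IsBandTest N g →
      Integrable (fun u : Torus.energySpace (Fin 3) => Torus.nsGeneratorPairing ν f u g) μ ∧ ∫ u : Torus.energySpace (Fin 3), Torus.nsGeneratorPairing ν f u g ∂μ = 0)
    (g : UnitAddTorus (Fin 3) → EuclideanSpace ℝ (Fin 3)) (hg : IsBandTest N g) :
    Integrable (fun u : Torus.energySpace (Fin 3) => Torus.nsGeneratorPairing ν f u g)
        (((Fintype.card κ : ℝ≥0∞))⁻¹ • ∑ p, Measure.map (T (e p)) μ) ∧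
      ∫ u : Torus.energySpace (Fin 3), Torus.nsGeneratorPairing ν f u g
        ∂(((Fintype.card κ : ℝ≥0∞))⁻¹ • ∑ p, Measure.map (T (e p)) μ) = 0 := by
  have hband : ∀ p, IsBandTest N fun x => g (x - e p) := fun p => by
    simp only [sub_eq_add_neg]; exact isBandTest_comp_add_right hg _
  have hrow : ∀ p, (fun u : Torus.energySpace (Fin 3) => Torus.nsGeneratorPairing ν f (T (e p) u) g) =
      fun u => Torus.nsGeneratorPairing ν f u fun x => g (x - e p) :=
    fun p => funext fun u => nsGeneratorPairing_shiftOp hT ν (hf p) u g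
  have hint : ∀ p, Integrable (fun u : Torus.energySpace (Fin 3) => Torus.nsGeneratorPairing ν f (T (e p) u) g) μ :=
    fun p => by rw [hrow p]; exact (hlin _ (hband p)).1
  refine ⟨integrable_shiftAverage T e μ hint, ?_⟩
  rw [integral_shiftAverage T e μ hint]
  simp only [hrow, fun p => (hlin _ (hband p)).2, Finset.sum_const_zero, mul_zero]

/-- **The energy row of the averaged law** (force fixed by the translations). [folklore] -/
theorem energyRow_shiftAverage [Nonempty κ] (ν : ℝ) {f : UnitAddTorus (Fin 3) → EuclideanSpace ℝ (Fin 3)}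
    (hf : ∀ p x, f (x + e p) = f x) (N : ℕ)
    (hErow : Integrable (fun u : Torus.energySpace (Fin 3) => Torus.nsGeneratorPairing ν f u (Torus.fourierTruncate N (u.1 : UnitAddTorus (Fin 3) → EuclideanSpace ℝ (Fin 3)))) μ ∧
      ∫ u : Torus.energySpace (Fin 3), Torus.nsGeneratorPairing ν f u (Torus.fourierTruncate N (u.1 : UnitAddTorus (Fin 3) → EuclideanSpace ℝ (Fin 3))) ∂μ = 0) :
    Integrable (fun u : Torus.energySpace (Fin 3) => Torus.nsGeneratorPairing ν f u
        (Torus.fourierTruncate N (u.1 : UnitAddTorus (Fin 3) → EuclideanSpace ℝ (Fin 3))))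
        (((Fintype.card κ : ℝ≥0∞))⁻¹ • ∑ p, Measure.map (T (e p)) μ) ∧
      ∫ u : Torus.energySpace (Fin 3), Torus.nsGeneratorPairing ν f u
        (Torus.fourierTruncate N (u.1 : UnitAddTorus (Fin 3) → EuclideanSpace ℝ (Fin 3)))
        ∂(((Fintype.card κ : ℝ≥0∞))⁻¹ • ∑ p, Measure.map (T (e p)) μ) = 0 := by
  have hinv : ∀ p (u : Torus.energySpace (Fin 3)), Torus.nsGeneratorPairing ν f (T (e p) u)
      (Torus.fourierTruncate N ((T (e p) u).1 : UnitAddTorus (Fin 3) → EuclideanSpace ℝ (Fin 3))) =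
      Torus.nsGeneratorPairing ν f u (Torus.fourierTruncate N (u.1 : UnitAddTorus (Fin 3) → EuclideanSpace ℝ (Fin 3))) :=
    fun p u => nsGeneratorPairing_fourierTruncate_shiftOp hT ν (hf p) N u
  refine ⟨integrable_shiftAverage T e μ fun p => by simp_rw [hinv p]; exact hErow.1, ?_⟩
  rw [integral_shiftAverage_of_invariant T e μ hinv hErow.1, hErow.2]

/-- **The helicity row of the averaged law** (force fixed by the translations). [folklore] -/
theorem helicityRow_shiftAverage [Nonempty κ] (ν : ℝ) {f : UnitAddTorus (Fin 3) → EuclideanSpace ℝ (Fin 3)}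
    (hf : ∀ p x, f (x + e p) = f x) (N : ℕ)
    (hHrow : Integrable (fun u : Torus.energySpace (Fin 3) => Torus.nsGeneratorPairing ν f u (BDSV.curl (Torus.fourierTruncate N (u.1 : UnitAddTorus (Fin 3) → EuclideanSpace ℝ (Fin 3))))) μ ∧
      ∫ u : Torus.energySpace (Fin 3), Torus.nsGeneratorPairing ν f u (BDSV.curl (Torus.fourierTruncate N (u.1 : UnitAddTorus (Fin 3) → EuclideanSpace ℝ (Fin 3)))) ∂μ = 0) :
    Integrable (fun u : Torus.energySpace (Fin 3) => Torus.nsGeneratorPairing ν f u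
        (BDSV.curl (Torus.fourierTruncate N (u.1 : UnitAddTorus (Fin 3) → EuclideanSpace ℝ (Fin 3)))))
        (((Fintype.card κ : ℝ≥0∞))⁻¹ • ∑ p, Measure.map (T (e p)) μ) ∧
      ∫ u : Torus.energySpace (Fin 3), Torus.nsGeneratorPairing ν f u
        (BDSV.curl (Torus.fourierTruncate N (u.1 : UnitAddTorus (Fin 3) → EuclideanSpace ℝ (Fin 3))))
        ∂(((Fintype.card κ : ℝ≥0∞))⁻¹ • ∑ p, Measure.map (T (e p)) μ) = 0 := by
  have hinv : ∀ p (u : Torus.energySpace (Fin 3)), Torus.nsGeneratorPairing ν f (T (e p) u)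
      (BDSV.curl (Torus.fourierTruncate N ((T (e p) u).1 : UnitAddTorus (Fin 3) → EuclideanSpace ℝ (Fin 3)))) =
      Torus.nsGeneratorPairing ν f u (BDSV.curl (Torus.fourierTruncate N (u.1 : UnitAddTorus (Fin 3) → EuclideanSpace ℝ (Fin 3)))) :=
    fun p u => nsGeneratorPairing_curl_fourierTruncate_shiftOp hT ν (hf p) N u
  refine ⟨integrable_shiftAverage T e μ fun p => by simp_rw [hinv p]; exact hHrow.1, ?_⟩
  rw [integral_shiftAverage_of_invariant T e μ hinv hHrow.1, hHrow.2]

/-- **Nondegenerate covariance is inherited by the averaged law** (Jensen: the variance of the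
average dominates the average of the variances, each of which is positive because translates of
band tests not vanishing on `V_N` are again such). [folklore] -/
theorem nondegenerate_shiftAverage [Nonempty κ] [IsFiniteMeasure μ] {N : ℕ}
    (hnd : ∀ g : UnitAddTorus (Fin 3) → EuclideanSpace ℝ (Fin 3), IsBandTest N g →
      (∃ u : Torus.energySpace (Fin 3), IsLevel N u ∧ Torus.pairing u.1 g ≠ 0) →
      (∫ u : Torus.energySpace (Fin 3), Torus.pairing u.1 g ∂μ) ^ 2 < ∫ u : Torus.energySpace (Fin 3), (Torus.pairing u.1 g) ^ 2 ∂μ)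
    (g : UnitAddTorus (Fin 3) → EuclideanSpace ℝ (Fin 3)) (hg : IsBandTest N g)
    (hex : ∃ u : Torus.energySpace (Fin 3), IsLevel N u ∧ Torus.pairing u.1 g ≠ 0) :
    (∫ u : Torus.energySpace (Fin 3), Torus.pairing u.1 g ∂(((Fintype.card κ : ℝ≥0∞))⁻¹ • ∑ p, Measure.map (T (e p)) μ)) ^ 2 <
      ∫ u : Torus.energySpace (Fin 3), (Torus.pairing u.1 g) ^ 2
        ∂(((Fintype.card κ : ℝ≥0∞))⁻¹ • ∑ p, Measure.map (T (e p)) μ) := by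
  have hband : ∀ p, IsBandTest N fun x => g (x - e p) := fun p => by
    simp only [sub_eq_add_neg]; exact isBandTest_comp_add_right hg _
  -- the translated tests do not vanish on `V_N` either
  have hex' : ∀ p, ∃ u : Torus.energySpace (Fin 3), IsLevel N u ∧ Torus.pairing u.1 (fun x => g (x - e p)) ≠ 0 := by
    intro p
    obtain ⟨u, hu, hne⟩ := hex
    refine ⟨T (-e p) u, (isLevel_shiftOp_iff hT N _ u).2 hu, ?_⟩
    rw [pairing_shiftOp hT]
    simpa only [sub_neg_eq_add, add_sub_cancel_right] using hne
  have hrow : ∀ p, (fun u : Torus.energySpace (Fin 3) => Torus.pairing (T (e p) u).1 g) =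
      fun u => Torus.pairing u.1 fun x => g (x - e p) := fun p => funext fun u => pairing_shiftOp hT (e p) u g
  have hstrict : ∀ p, (∫ u : Torus.energySpace (Fin 3), Torus.pairing u.1 (fun x => g (x - e p)) ∂μ) ^ 2 <
      ∫ u : Torus.energySpace (Fin 3), (Torus.pairing u.1 fun x => g (x - e p)) ^ 2 ∂μ := fun p => hnd _ (hband p) (hex' p)
  -- integrability of the translated observables and their squares
  have hmeas : ∀ p, AEStronglyMeasurable (fun u : Torus.energySpace (Fin 3) => Torus.pairing u.1 fun x => g (x - e p)) μ :=
    fun p => (Torus.continuous_pairing_coe ((hband p).1.memLp 2)).aestronglyMeasurable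
  have hint2 : ∀ p, Integrable (fun u : Torus.energySpace (Fin 3) => (Torus.pairing u.1 fun x => g (x - e p)) ^ 2) μ := by
    intro p
    by_contra h
    have := (sq_nonneg _).trans_lt (hstrict p)
    rw [integral_undef h] at this
    exact lt_irrefl _ this
  have hint1 : ∀ p, Integrable (fun u : Torus.energySpace (Fin 3) => Torus.pairing u.1 fun x => g (x - e p)) μ :=
    fun p => ((memLp_two_iff_integrable_sq (hmeas p)).2 (hint2 p)).integrable one_le_two
  rw [integral_shiftAverage T e μ (F := fun u => Torus.pairing u.1 g) fun p => by rw [hrow p]; exact hint1 p,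
    integral_shiftAverage T e μ (F := fun u => (Torus.pairing u.1 g) ^ 2) fun p => by
      simp_rw [pairing_shiftOp hT (e p) _ g]; exact hint2 p]
  simp_rw [pairing_shiftOp hT (e _) _ g]
  set m : κ → ℝ := fun p => ∫ u : Torus.energySpace (Fin 3), Torus.pairing u.1 (fun x => g (x - e p)) ∂μ with hm
  set s : κ → ℝ := fun p => ∫ u : Torus.energySpace (Fin 3), (Torus.pairing u.1 fun x => g (x - e p)) ^ 2 ∂μ with hs
  have hn : (0 : ℝ) < Fintype.card κ := by exact_mod_cast Fintype.card_pos
  have hJ : (∑ p, m p) ^ 2 ≤ Fintype.card κ * ∑ p, m p ^ 2 := sq_sum_le_card_mul_sum_sq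
  have hS : ∑ p, m p ^ 2 < ∑ p, s p := Finset.sum_lt_sum_of_nonempty Finset.univ_nonempty fun p _ => hstrict p
  show ((Fintype.card κ : ℝ)⁻¹ * ∑ p, m p) ^ 2 < (Fintype.card κ : ℝ)⁻¹ * ∑ p, s p
  rw [mul_pow, lt_inv_mul_iff₀ hn]
  calc (Fintype.card κ : ℝ) * (((Fintype.card κ : ℝ))⁻¹ ^ 2 * (∑ p, m p) ^ 2)
      = (Fintype.card κ : ℝ)⁻¹ * (∑ p, m p) ^ 2 := by field_simp
    _ ≤ (Fintype.card κ : ℝ)⁻¹ * (Fintype.card κ * ∑ p, m p ^ 2) := mul_le_mul_of_nonneg_left hJ (by positivity)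
    _ = ∑ p, m p ^ 2 := by field_simp
    _ < ∑ p, s p := hS

/-- **Cylindrical laws of the averaged law are invariant under the translation group**: if the
translations `e p` form a group (`e (p - q) = e p - e q`), then for every `q` and every finite family
of smooth tests `g`, the law of `((u, gᵢ(· + e q)))ᵢ` under `μ'` equals the law of `((u, gᵢ))ᵢ`.
[folklore] -/
theorem map_pairings_shiftAverage [AddGroup κ] (hsub : ∀ p q, e (p - q) = e p - e q) (q : κ)
    {m : ℕ} (g : Fin m → UnitAddTorus (Fin 3) → EuclideanSpace ℝ (Fin 3)) (hg : ∀ i, Torus.IsSmooth (g i)) :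
    Measure.map (fun u : Torus.energySpace (Fin 3) => fun i => Torus.pairing u.1 (fun x => g i (x + e q)))
        (((Fintype.card κ : ℝ≥0∞))⁻¹ • ∑ p, Measure.map (T (e p)) μ) =
      Measure.map (fun u : Torus.energySpace (Fin 3) => fun i => Torus.pairing u.1 (g i))
        (((Fintype.card κ : ℝ≥0∞))⁻¹ • ∑ p, Measure.map (T (e p)) μ) := by
  have hΦ : ∀ a : UnitAddTorus (Fin 3), Measurable fun u : Torus.energySpace (Fin 3) => fun i =>
      Torus.pairing u.1 (fun x => g i (x + a)) := fun a =>
    (continuous_pi fun i => Torus.continuous_pairing_coe (((hg i).comp_add_right a).memLp 2)).measurable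
  have hΦ0 : Measurable fun u : Torus.energySpace (Fin 3) => fun i => Torus.pairing u.1 (g i) :=
    (continuous_pi fun i => Torus.continuous_pairing_coe ((hg i).memLp 2)).measurable
  rw [Measure.map_smul, Measure.map_smul, map_finsetSum_measure (hΦ _), map_finsetSum_measure hΦ0]
  congr 1
  simp_rw [Measure.map_map (hΦ _) (T (e _)).continuous.measurable,
    Measure.map_map hΦ0 (T (e _)).continuous.measurable]
  -- `Φ_a ∘ T (e p) = Φ_0 ∘ T (e (p - q))`
  have hcomp : ∀ p, ((fun u : Torus.energySpace (Fin 3) => fun i => Torus.pairing u.1 (fun x => g i (x + e q))) ∘ (T (e p))) =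
      ((fun u : Torus.energySpace (Fin 3) => fun i => Torus.pairing u.1 (g i)) ∘ (T (e (p - q)))) := by
    intro p
    funext u
    funext i
    simp only [Function.comp_apply, pairing_shiftOp hT, hsub]
    congr 1
    funext x
    congr 1
    abel
  simp_rw [hcomp]
  exact Fintype.sum_equiv (Equiv.subRight q) _ _ fun p => rfl

end Average

/-! ## The shear grid `(ℤ/L)² → H_L` and the assembly -/

/-- **An element of `ℝ/ℤ` killed by `L ≠ 0` is of the form `j/L`, `j ∈ ℤ/L`.** [folklore] -/
theorem exists_toAddCircle_eq_of_nsmul_eq_zero {L : ℕ} [NeZero L] {x : UnitAddCircle} (hx : L • x = 0) :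
    ∃ j : ZMod L, ZMod.toAddCircle j = x := by
  obtain ⟨⟨r, hr⟩, rfl⟩ : ∃ y : Set.Ico (0 : ℝ) (0 + 1), ((y : ℝ) : UnitAddCircle) = x :=
    ⟨AddCircle.equivIco 1 0 x, AddCircle.coe_equivIco⟩
  have h : ((L • r : ℝ) : UnitAddCircle) = 0 := by rw [AddCircle.coe_nsmul]; exact hx
  obtain ⟨n, hn⟩ := (AddCircle.coe_eq_zero_iff (1 : ℝ)).mp h
  rw [zsmul_eq_mul, mul_one, nsmul_eq_mul] at hn
  have hL : (L : ℝ) ≠ 0 := Nat.cast_ne_zero.mpr (NeZero.ne L)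
  refine ⟨(n : ZMod L), ?_⟩
  rw [ZMod.toAddCircle_intCast, hn, mul_div_cancel_left₀ _ hL]

/-- **The shear grid**: the map `(ℤ/L)² → T³`, `p ↦ (p₁/L, 0, p₂/L)` is a group homomorphism onto
the finite shear group `H_L = {a | a 1 = 0, L • a = 0}`. [folklore] -/
theorem exists_shearGrid (L : ℕ) [NeZero L] :
    ∃ e : ZMod L × ZMod L → UnitAddTorus (Fin 3),
      (∀ p, e p 1 = 0) ∧ (∀ p q, e (p - q) = e p - e q) ∧
      ∀ a : UnitAddTorus (Fin 3), a 1 = 0 → L • a = 0 → ∃ q, e q = a := by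
  refine ⟨fun p => ![ZMod.toAddCircle p.1, 0, ZMod.toAddCircle p.2], fun p => rfl, fun p q => ?_, fun a ha hLa => ?_⟩
  · funext i
    fin_cases i <;> simp
  · have h0 : L • a 0 = 0 := by simpa using congrFun hLa 0
    have h2 : L • a 2 = 0 := by simpa using congrFun hLa 2
    obtain ⟨j0, hj0⟩ := exists_toAddCircle_eq_of_nsmul_eq_zero h0
    obtain ⟨j2, hj2⟩ := exists_toAddCircle_eq_of_nsmul_eq_zero h2
    refine ⟨(j0, j2), funext fun i => ?_⟩
    fin_cases i
    · simpa using hj0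
    · simpa using ha.symm
    · simpa using hj2

/-- **Symmetrisation of an order-2 design.** For a shear-invariant force `f` and a probability law
`μ` on `H` satisfying the clauses of the order-2 design (level `N`, bounded support, nondegenerate
covariance, exact linear / energy / helicity rows), and every `L ≥ 1`, the average of `μ` over the
shear group `H_L = {a | a 1 = 0, L • a = 0}` satisfies the same clauses, has the same mean energy
and dissipation, and its cylindrical laws are `H_L`-invariant. [folklore] -/
theorem exists_lawSym_of_design (ν : ℝ) {f : UnitAddTorus (Fin 3) → EuclideanSpace ℝ (Fin 3)}
    (hfa : ∀ a : UnitAddTorus (Fin 3), a 1 = 0 → ∀ x, f (x + a) = f x) (N L : ℕ) (hL : 0 < L)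
    (μ : Measure (Torus.energySpace (Fin 3))) (hp : IsProbabilityMeasure μ) (hlev : ∀ᵐ u ∂μ, IsLevel N u)
    (hR : ∃ R : ℝ, ∀ᵐ u ∂μ, ‖u‖ ≤ R)
    (hnd : ∀ g : UnitAddTorus (Fin 3) → EuclideanSpace ℝ (Fin 3), IsBandTest N g →
      (∃ u : Torus.energySpace (Fin 3), IsLevel N u ∧ Torus.pairing u.1 g ≠ 0) →
      (∫ u : Torus.energySpace (Fin 3), Torus.pairing u.1 g ∂μ) ^ 2 < ∫ u : Torus.energySpace (Fin 3), (Torus.pairing u.1 g) ^ 2 ∂μ)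
    (hlin : ∀ g : UnitAddTorus (Fin 3) → EuclideanSpace ℝ (Fin 3), IsBandTest N g →
      Integrable (fun u : Torus.energySpace (Fin 3) => Torus.nsGeneratorPairing ν f u g) μ ∧ ∫ u : Torus.energySpace (Fin 3), Torus.nsGeneratorPairing ν f u g ∂μ = 0)
    (hErow : Integrable (fun u : Torus.energySpace (Fin 3) => Torus.nsGeneratorPairing ν f u (Torus.fourierTruncate N (u.1 : UnitAddTorus (Fin 3) → EuclideanSpace ℝ (Fin 3)))) μ ∧
      ∫ u : Torus.energySpace (Fin 3), Torus.nsGeneratorPairing ν f u (Torus.fourierTruncate N (u.1 : UnitAddTorus (Fin 3) → EuclideanSpace ℝ (Fin 3))) ∂μ = 0)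
    (hHrow : Integrable (fun u : Torus.energySpace (Fin 3) => Torus.nsGeneratorPairing ν f u (BDSV.curl (Torus.fourierTruncate N (u.1 : UnitAddTorus (Fin 3) → EuclideanSpace ℝ (Fin 3))))) μ ∧
      ∫ u : Torus.energySpace (Fin 3), Torus.nsGeneratorPairing ν f u (BDSV.curl (Torus.fourierTruncate N (u.1 : UnitAddTorus (Fin 3) → EuclideanSpace ℝ (Fin 3)))) ∂μ = 0) :
    ∃ μ₀ : Measure (Torus.energySpace (Fin 3)), IsProbabilityMeasure μ₀ ∧ (∀ᵐ u ∂μ₀, IsLevel N u) ∧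
    (∃ R : ℝ, ∀ᵐ u ∂μ₀, ‖u‖ ≤ R) ∧
    (∀ g : UnitAddTorus (Fin 3) → EuclideanSpace ℝ (Fin 3), IsBandTest N g →
      (∃ u : Torus.energySpace (Fin 3), IsLevel N u ∧ Torus.pairing u.1 g ≠ 0) →
      (∫ u : Torus.energySpace (Fin 3), Torus.pairing u.1 g ∂μ₀) ^ 2 < ∫ u : Torus.energySpace (Fin 3), (Torus.pairing u.1 g) ^ 2 ∂μ₀) ∧
    (∀ a : UnitAddTorus (Fin 3), a 1 = 0 → L • a = 0 →
      ∀ (m : ℕ) (g : Fin m → UnitAddTorus (Fin 3) → EuclideanSpace ℝ (Fin 3)),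
      (∀ i, IsBandTest N (g i)) →
      Measure.map (fun u : Torus.energySpace (Fin 3) => fun i => Torus.pairing u.1 (fun x => g i (x + a))) μ₀ =
        Measure.map (fun u : Torus.energySpace (Fin 3) => fun i => Torus.pairing u.1 (g i)) μ₀) ∧
    (∀ g : UnitAddTorus (Fin 3) → EuclideanSpace ℝ (Fin 3), IsBandTest N g →
      Integrable (fun u : Torus.energySpace (Fin 3) => Torus.nsGeneratorPairing ν f u g) μ₀ ∧ ∫ u : Torus.energySpace (Fin 3), Torus.nsGeneratorPairing ν f u g ∂μ₀ = 0) ∧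
    (Integrable (fun u : Torus.energySpace (Fin 3) => Torus.nsGeneratorPairing ν f u
        (Torus.fourierTruncate N (u.1 : UnitAddTorus (Fin 3) → EuclideanSpace ℝ (Fin 3)))) μ₀ ∧
      ∫ u : Torus.energySpace (Fin 3), Torus.nsGeneratorPairing ν f u
        (Torus.fourierTruncate N (u.1 : UnitAddTorus (Fin 3) → EuclideanSpace ℝ (Fin 3))) ∂μ₀ = 0) ∧
    (Integrable (fun u : Torus.energySpace (Fin 3) => Torus.nsGeneratorPairing ν f u
        (BDSV.curl (Torus.fourierTruncate N (u.1 : UnitAddTorus (Fin 3) → EuclideanSpace ℝ (Fin 3))))) μ₀ ∧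
      ∫ u : Torus.energySpace (Fin 3), Torus.nsGeneratorPairing ν f u
        (BDSV.curl (Torus.fourierTruncate N (u.1 : UnitAddTorus (Fin 3) → EuclideanSpace ℝ (Fin 3)))) ∂μ₀ = 0) ∧
    Torus.ensembleEnergy μ₀ = Torus.ensembleEnergy μ ∧
    Torus.ensembleDissipation ν μ₀ = Torus.ensembleDissipation ν μ := by
  haveI : NeZero L := ⟨hL.ne'⟩
  haveI := hp
  obtain ⟨T, hT⟩ := exists_shiftOp
  obtain ⟨e, he1, hsub, hsurj⟩ := exists_shearGrid L
  obtain ⟨R, hR⟩ := hR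
  have hf : ∀ p x, f (x + e p) = f x := fun p => hfa (e p) (he1 p)
  refine ⟨((Fintype.card (ZMod L × ZMod L) : ℝ≥0∞))⁻¹ • ∑ p, Measure.map (T (e p)) μ,
    isProbabilityMeasure_shiftAverage T e μ, ae_isLevel_shiftAverage e μ hT hlev,
    ⟨R, ae_norm_le_shiftAverage e μ hT hR⟩, nondegenerate_shiftAverage e μ hT hnd, ?_,
    linearRow_shiftAverage e μ hT ν hf hlin, energyRow_shiftAverage e μ hT ν hf N hErow,
    helicityRow_shiftAverage e μ hT ν hf N hHrow, ensembleEnergy_shiftAverage e μ hT hR,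
    ensembleDissipation_shiftAverage e μ hT ν⟩
  intro a ha hLa m g hg
  obtain ⟨q, rfl⟩ := hsurj a ha hLa
  exact map_pairings_shiftAverage e μ hT hsub q g fun i => (hg i).1

end

/-- **Registered sub-goal `designSymLaw_exists_shearGrid` of stub S6′** (summary of this file's
group bookkeeping): the grid `(ℤ/L)² → T³`, `p ↦ (p₁/L, 0, p₂/L)` is a homomorphism onto the finite
shear group `H_L`. [folklore] -/
theorem designSymLaw_exists_shearGrid : ∀ (L : ℕ) [NeZero L], ∃ e : ZMod L × ZMod L → UnitAddTorus (Fin 3), (∀ p, e p 1 = 0) ∧ (∀ p q, e (p - q) = e p - e q) ∧ ∀ a : UnitAddTorus (Fin 3), a 1 = 0 → L • a = 0 → ∃ q, e q = a :=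
  fun L _ => exists_shearGrid L

end Summit.AnomalousDissipation.AnomalousDissipation.Theorems.MomentParityQuarticGate
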